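import Summits.AtomisticToContinuum.BoseEinsteinCondensation.Theorems.BECGroundStateSOSPeriodicIRBoundTwoSectorPairDefs
import Literature.Barriers.CriticalPhenomena.RigorousRGSmallParameterLazyWalk
import HarnessLib

/-!
# Route `BECGroundStateSOS`, crux `PeriodicIRBound` (stmt-AtomisticToContinuum-3972), line `two-sector-gd-transfer` (v11) —
# stub S11e `stub_potCosLowerBound : PotCosLowerBound`

Supports (does not close) stmt-AtomisticToContinuum-3972. Lead seat c23 (`Cruxes/PeriodicIRBound/SOFT-LOCATION.md`, Step 4).
For a measurable potential `w ≥ 0` of range `R` with `∫ w(|z|)dz < ∞`, `L > 0` and a dual-lattice momentum `p = 2πk/L`,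
the cosine transform of the periodised potential over the cell obeys `v̂_L(p) ≥ ‖w‖₁(1 − ‖p‖R)`.

Proof. Write `cos = 1 − (1 − cos)`. In `ℝ≥0∞`, `∫_{cell} w^per(z)(1 − cos(p·z)) dz = ∫_{ℝ³} w(|z|)(1 − cos(p·z)) dz` (the
translates of the cell tile `ℝ³`, `tsum_lintegral_cell_sub_latticeVec`, and `cos(p·(z + Ln)) = cos(p·z)` for dual `p`), and
`w(|z|)(1 − cos(p·z)) ≤ w(|z|)‖p‖R` pointwise (`1 − cos t ≤ |t|`, in tree as `LongRangePhi4.one_sub_cos_le_abs`, `|p·z| ≤ ‖p‖‖z‖`, and `w(|z|) = 0` for `|z| > R`), so it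
is `≤ ‖p‖R‖w‖₁`; the constant term is `∫_{cell} w^per = ‖w‖₁` (`WF.lintegral_cell_periodizedPotential_sub`). Passing to the
Bochner integral defining `potCos` gives the claim. Elementary; nothing is cited.
-/

noncomputable section

open scoped BigOperators ENNReal
open MeasureTheory

namespace Summit.AtomisticToContinuum.BoseEinsteinCondensation.Cruxes.PeriodicIRBound.TwoSectorGdTransfer

open Literature.MathematicalPhysics.QuantumManyBody.BoseGas
open Summit.AtomisticToContinuum.BoseEinsteinCondensation.Cruxes.PeriodicIRBound.LinearPhFloorWagner.WF

namespace PotCosLower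

/-- The phase `p·z = ∑ⱼ pⱼ zⱼ` of the dual-lattice momentum `p = 2πk/L` is `Lℤ³`-periodic up to `2πℤ`:
`p·(z − Ln) = p·z − 2π(k·n)`. [folklore] -/
theorem phase_sub_latticeVec {L : ℝ} (hL : L ≠ 0) (k n : Fin 3 → ℤ) (z : Space) :
    ∑ j, latticeVec (2 * Real.pi / L) k j * (z - latticeVec L n) j =
      ∑ j, latticeVec (2 * Real.pi / L) k j * z j - 2 * Real.pi * ∑ j, ((k j * n j : ℤ) : ℝ) := by
  have h : ∀ j, latticeVec (2 * Real.pi / L) k j * (z - latticeVec L n) j =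
      latticeVec (2 * Real.pi / L) k j * z j - 2 * Real.pi * ((k j * n j : ℤ) : ℝ) := by
    intro j
    rw [show (z - latticeVec L n) j = z j - latticeVec L n j from rfl,
      show latticeVec (2 * Real.pi / L) k j = 2 * Real.pi / L * k j from rfl,
      show latticeVec L n j = L * n j from rfl]
    push_cast
    field_simp
  simp only [h, Finset.sum_sub_distrib, Finset.mul_sum]

/-- `cos(p·(z − Ln)) = cos(p·z)` for dual `p = 2πk/L`. [folklore] -/
theorem cos_phase_sub_latticeVec {L : ℝ} (hL : L ≠ 0) (k n : Fin 3 → ℤ) (z : Space) :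
    Real.cos (∑ j, latticeVec (2 * Real.pi / L) k j * (z - latticeVec L n) j) =
      Real.cos (∑ j, latticeVec (2 * Real.pi / L) k j * z j) := by
  rw [phase_sub_latticeVec hL, show (2 : ℝ) * Real.pi * (∑ j, ((k j * n j : ℤ) : ℝ)) =
    ((∑ j, k j * n j : ℤ) : ℝ) * (2 * Real.pi) by push_cast; ring, Real.cos_sub_int_mul_two_pi]

/-- `|p·z| ≤ ‖p‖‖z‖` (Cauchy–Schwarz on `ℝ³`). [folklore] -/
theorem abs_phase_le (p z : Space) : |∑ j, p j * z j| ≤ ‖p‖ * ‖z‖ := by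
  have h : ∑ j, p j * z j = inner ℝ z p := by
    rw [PiLp.inner_apply]
    simp
  rw [h]
  exact (abs_real_inner_le_norm z p).trans_eq (mul_comm _ _)

/-- The coordinate maps of `ℝ³` are measurable. [folklore] -/
theorem measurable_coord (j : Fin 3) : Measurable fun z : Space => z j :=
  (EuclideanSpace.proj (𝕜 := ℝ) j).continuous.measurable

/-- The phase `z ↦ p·z` is measurable. [folklore] -/
theorem measurable_phase (p : Space) : Measurable fun z : Space => ∑ j, p j * z j :=
  Finset.measurable_sum _ fun j _ => measurable_const.mul (measurable_coord j)

/-- **Unfolding the periodisation against a periodic weight**: for dual `p`,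
`∫_{cell} w^per(z)·(1 − cos(p·z)) dz = ∫_{ℝ³} w(|z|)(1 − cos(p·z)) dz` in `ℝ≥0∞`. [folklore] -/
theorem lintegral_cell_periodized_mul_oneSubCos {L : ℝ} (hL : 0 < L) {w : ℝ → ℝ≥0∞} (hw : Measurable w)
    (k : Fin 3 → ℤ) :
    ∫⁻ z in cell L, periodizedPotential w L z *
        ENNReal.ofReal (1 - Real.cos (∑ j, latticeVec (2 * Real.pi / L) k j * z j)) =
      ∫⁻ z : Space, w ‖z‖ * ENNReal.ofReal (1 - Real.cos (∑ j, latticeVec (2 * Real.pi / L) k j * z j)) := by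
  set g : Space → ℝ≥0∞ := fun z => ENNReal.ofReal (1 - Real.cos (∑ j, latticeVec (2 * Real.pi / L) k j * z j))
    with hg
  have hgm : Measurable g :=
    ENNReal.measurable_ofReal.comp (measurable_const.sub (Real.measurable_cos.comp (measurable_phase _)))
  have hgper : ∀ (n : Fin 3 → ℤ) (z : Space), g (z - latticeVec L n) = g z := by
    intro n z
    show ENNReal.ofReal (1 - Real.cos (∑ j, latticeVec (2 * Real.pi / L) k j * (z - latticeVec L n) j)) =
      ENNReal.ofReal (1 - Real.cos (∑ j, latticeVec (2 * Real.pi / L) k j * z j))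
    rw [cos_phase_sub_latticeVec hL.ne' k n z]
  unfold periodizedPotential
  simp_rw [← ENNReal.tsum_mul_right]
  rw [lintegral_tsum fun n => ?_]
  · calc ∑' n : Fin 3 → ℤ, ∫⁻ z in cell L, w ‖z - latticeVec L n‖ * g z
        = ∑' n : Fin 3 → ℤ, ∫⁻ z in cell L, (fun u => w ‖u‖ * g u) (z - latticeVec L n) := by
          refine tsum_congr fun n => lintegral_congr fun z => ?_
          show w ‖z - latticeVec L n‖ * g z = w ‖z - latticeVec L n‖ * g (z - latticeVec L n)
          rw [hgper n z]
      _ = ∫⁻ u, w ‖u‖ * g u := tsum_lintegral_cell_sub_latticeVec hL fun u => w ‖u‖ * g u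
  · exact (((hw.comp measurable_norm).comp (measurable_id.sub measurable_const)).mul hgm).aemeasurable

/-- **The pointwise bound under the range condition**: `w(|z|)(1 − cos(p·z)) ≤ w(|z|)·‖p‖R`. [folklore] -/
theorem weight_mul_oneSubCos_le {w : ℝ → ℝ≥0∞} {R : ℝ} (hsupp : ∀ r : ℝ, R < r → w r = 0)
    (p z : Space) :
    w ‖z‖ * ENNReal.ofReal (1 - Real.cos (∑ j, p j * z j)) ≤ w ‖z‖ * ENNReal.ofReal (‖p‖ * R) := by
  rcases lt_or_ge R ‖z‖ with hz | hz
  · rw [hsupp _ hz, zero_mul, zero_mul]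
  · refine mul_le_mul' le_rfl (ENNReal.ofReal_le_ofReal ?_)
    calc 1 - Real.cos (∑ j, p j * z j) ≤ |∑ j, p j * z j| :=
          Literature.Barriers.CriticalPhenomena.LongRangePhi4.one_sub_cos_le_abs _
      _ ≤ ‖p‖ * ‖z‖ := abs_phase_le p z
      _ ≤ ‖p‖ * R := mul_le_mul_of_nonneg_left hz (norm_nonneg _)

end PotCosLower

open PotCosLower in
/-- **Stub S11e of the line `two-sector-gd-transfer` (v11)** — the cosine transform of the periodised potential on the
window: `v̂_L(p) ≥ ‖w‖₁(1 − ‖p‖R)` for a potential of range `R` and a dual-lattice `p`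
(`Cruxes/PeriodicIRBound/SOFT-LOCATION.md`, Step 4). [folklore] -/
theorem stub_potCosLowerBound : PotCosLowerBound := by
  intro w hw hint R hR hsupp L hL k
  set p : Space := latticeVec (2 * Real.pi / L) k with hp
  set φ : Space → ℝ := fun z => ∑ j, p j * z j with hφ
  -- finiteness of the periodised potential on the cell
  have hcell : ∫⁻ z in cell L, periodizedPotential w L z = ∫⁻ z : Space, w ‖z‖ := by
    have h := Literature.MathematicalPhysics.QuantumManyBody.BoseGas.lintegral_cell_periodizedPotential_sub hL hw
      (0 : Space)
    simpa only [sub_zero] using h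
  have hfin : ∫⁻ z in cell L, periodizedPotential w L z ≠ ⊤ := by rw [hcell]; exact hint
  have hWm : Measurable (periodizedPotential w L) := measurable_periodizedPotential_tk hw L
  have hWi : Integrable (fun z => (periodizedPotential w L z).toReal) ((volume : Measure Space).restrict (cell L)) :=
    integrable_toReal_of_lintegral_ne_top hWm.aemeasurable hfin
  have hφm : Measurable φ := measurable_phase p
  have hcosm : AEStronglyMeasurable (fun z => Real.cos (φ z)) ((volume : Measure Space).restrict (cell L)) :=
    (Real.measurable_cos.comp hφm).aestronglyMeasurable
  have h1cm : AEStronglyMeasurable (fun z => 1 - Real.cos (φ z)) ((volume : Measure Space).restrict (cell L)) :=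
    (measurable_const.sub (Real.measurable_cos.comp hφm)).aestronglyMeasurable
  -- the two Bochner integrals: `∫ W·cos φ = ∫ W − ∫ W(1 − cos φ)`
  have hIcos : Integrable (fun z => (periodizedPotential w L z).toReal * Real.cos (φ z))
      ((volume : Measure Space).restrict (cell L)) :=
    hWi.mul_bdd hcosm (ae_of_all _ fun z => by
      rw [Real.norm_eq_abs]; exact Real.abs_cos_le_one _)
  have hI1c : Integrable (fun z => (periodizedPotential w L z).toReal * (1 - Real.cos (φ z)))
      ((volume : Measure Space).restrict (cell L)) :=
    hWi.mul_bdd h1cm (ae_of_all _ fun z => show ‖1 - Real.cos (φ z)‖ ≤ 2 by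
      rw [Real.norm_eq_abs, abs_of_nonneg (by linarith [Real.cos_le_one (φ z)])]
      linarith [Real.neg_one_le_cos (φ z)])
  have hsplit : potCos w L p = (∫ z in cell L, (periodizedPotential w L z).toReal) -
      ∫ z in cell L, (periodizedPotential w L z).toReal * (1 - Real.cos (φ z)) := by
    rw [potCos, ← integral_sub hWi hI1c]
    refine integral_congr_ae (ae_of_all _ fun z => ?_)
    simp only [hφ]
    ring
  -- the constant term is `‖w‖₁`
  have hconst : (∫ z in cell L, (periodizedPotential w L z).toReal) = wL1 w := by
    rw [integral_toReal hWm.aemeasurable (ae_lt_top' hWm.aemeasurable hfin |> ae_restrict_of_ae_restrict_of_subset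
      subset_rfl), hcell]
    rfl
  -- the fluctuation term is `≤ ‖p‖R‖w‖₁`
  have hfluct : (∫ z in cell L, (periodizedPotential w L z).toReal * (1 - Real.cos (φ z))) ≤ ‖p‖ * R * wL1 w := by
    have hnn : ∀ z, 0 ≤ 1 - Real.cos (φ z) := fun z => by linarith [Real.cos_le_one (φ z)]
    have heq : (∫ z in cell L, (periodizedPotential w L z).toReal * (1 - Real.cos (φ z))) =
        (∫⁻ z in cell L, periodizedPotential w L z * ENNReal.ofReal (1 - Real.cos (φ z))).toReal := by
      rw [integral_eq_lintegral_of_nonneg_ae (ae_of_all _ fun z => mul_nonneg ENNReal.toReal_nonneg (hnn z))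
        (hWi.aestronglyMeasurable.mul h1cm)]
      congr 1
      refine lintegral_congr_ae ?_
      filter_upwards [ae_lt_top' (μ := (volume : Measure Space).restrict (cell L)) hWm.aemeasurable hfin] with z hz
      rw [ENNReal.ofReal_mul ENNReal.toReal_nonneg, ENNReal.ofReal_toReal hz.ne]
    rw [heq]
    have hle : ∫⁻ z in cell L, periodizedPotential w L z * ENNReal.ofReal (1 - Real.cos (φ z)) ≤
        ENNReal.ofReal (‖p‖ * R) * ∫⁻ z : Space, w ‖z‖ := by
      rw [show (fun z => periodizedPotential w L z * ENNReal.ofReal (1 - Real.cos (φ z))) =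
          fun z => periodizedPotential w L z *
            ENNReal.ofReal (1 - Real.cos (∑ j, latticeVec (2 * Real.pi / L) k j * z j)) from rfl,
        lintegral_cell_periodized_mul_oneSubCos hL hw k, ← lintegral_const_mul' _ _ ENNReal.ofReal_ne_top]
      refine lintegral_mono fun z => ?_
      rw [mul_comm (ENNReal.ofReal _)]
      exact weight_mul_oneSubCos_le hsupp p z
    have htop : ENNReal.ofReal (‖p‖ * R) * ∫⁻ z : Space, w ‖z‖ ≠ ⊤ := ENNReal.mul_ne_top ENNReal.ofReal_ne_top hint
    calc (∫⁻ z in cell L, periodizedPotential w L z * ENNReal.ofReal (1 - Real.cos (φ z))).toReal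
        ≤ (ENNReal.ofReal (‖p‖ * R) * ∫⁻ z : Space, w ‖z‖).toReal := ENNReal.toReal_mono htop hle
      _ = ‖p‖ * R * wL1 w := by
          rw [ENNReal.toReal_mul, ENNReal.toReal_ofReal (by positivity)]
          rfl
  rw [hsplit, hconst]
  nlinarith [hfluct]

end Summit.AtomisticToContinuum.BoseEinsteinCondensation.Cruxes.PeriodicIRBound.TwoSectorGdTransfer

end
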